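import Summits.FinalStateConjecture.FinalStateConjecture.Theorems.SwallowTheDatumParametricKerrBurialEngine
import Mathlib.Analysis.Calculus.ContDiff.Bounds
import Mathlib.Analysis.InnerProductSpace.Calculus

/-!
# `ParametricKerrBurial`, line `receding-annulus-universal-collar` — stub `stub_bulkInversion` (BK3e):
# the `C²` chain-rule bound through the unit inversion on the gluing annulus (crux item stmt-FinalStateConjecture-10052)

At the END site of the Brill–Lindquist bulk the metric is read through the sheet-2 inversion
`inv 1 x = x/‖x‖²` (engine file `SwallowTheDatumParametricKerrBurialEngine.lean`, def `inv`); the error term there is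
`x ↦ ‖x‖⁻¹ Φ(inv 1 x)` with `Φ` small in `C²` on the shell `{1/128 < ‖z‖ < 1/16}`.  For `x` on the gluing annulus
`32 ≤ ‖x‖ ≤ 64` one has `‖inv 1 x‖ = ‖x‖⁻¹ ∈ [1/64, 1/32]`, strictly inside the shell, and everything except `Φ` is
a FIXED smooth map on the open neighbourhood `U = {16 < ‖x‖ < 128}` of the compact annulus (which `inv 1` maps into the
shell).  Hence:

* §1 `‖inv 1 x‖ = ‖x‖⁻¹`, `inv 1` and `‖·‖⁻¹` are smooth off the origin, `U` is open and is mapped into the shell, the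
  annulus is compact;
* §2 compactness: the derivatives of orders `≤ 2` (within `U`) of a fixed `C²` map are bounded on the annulus by one constant;
* §3 the stub: Faà di Bruno (`norm_iteratedFDerivWithin_comp_le`: `‖Dⁿ(Φ ∘ inv 1)‖ ≤ n! ε Dⁿ`) and Leibniz
  (`norm_iteratedFDerivWithin_mul_le`) give `‖Dᵐ(‖x‖⁻¹ Φ(inv 1 x))‖ ≤ 8 B D² ε` for `m ≤ 2`, with the universal
  constants `B, D` of §2; `C²`-regularity at `x` follows from `C²`-regularity on the open set `U ∋ x`.

References: Mao–Oh–Tao arXiv:2308.13031 Rem 1.11 (the weak-field reading); Brill–Lindquist, Phys. Rev. 131 (1963) 471.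
-/

set_option linter.dupNamespace false

noncomputable section

namespace Summit.FinalStateConjecture.FinalStateConjecture.Theorems.SwallowTheDatum.ParametricKerrBurial

open scoped Manifold ContDiff Topology BigOperators InnerProductSpace Nat
open Bundle Set Filter Function MeasureTheory Literature.Geometry.Lorentzian
open Literature.Geometry.Lorentzian.MaoOhTao Literature.Geometry.Lorentzian.InitialDataSet

/-! ## §1 The unit inversion, the neighbourhood `U = {16 < ‖x‖ < 128}`, the shell and the annulus -/

/-- `‖inv 1 x‖ = ‖x‖⁻¹` (also at the junk point `0`). [folklore] -/
theorem bulkInversion_norm_inv_one (x : E3) : ‖inv 1 x‖ = ‖x‖⁻¹ := by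
  unfold inv
  rw [norm_smul, norm_div, norm_one, norm_pow, norm_norm]
  by_cases hx : ‖x‖ = 0
  · simp [hx]
  · field_simp

-- copied from `SwallowTheDatumUniversalWitnessFamilyStubCapEndAux2.lean` (`contDiffAt_sInv`, specialised to `ρ₃ = 1`)
/-- `inv 1` is `C^n` off the origin. [folklore] -/
theorem bulkInversion_contDiffAt_inv_one {x : E3} (hx : x ≠ 0) {n : WithTop ℕ∞} :
    ContDiffAt ℝ n (inv 1) x := by
  have hn : ‖x‖ ^ 2 ≠ 0 := pow_ne_zero 2 (norm_ne_zero_iff.2 hx)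
  unfold inv
  exact (contDiffAt_const.div (contDiff_norm_sq ℝ).contDiffAt hn).smul contDiffAt_id

/-- Points of `U = {16 < ‖x‖ < 128}` are nonzero. [folklore] -/
theorem bulkInversion_ne_zero_of_mem {x : E3} (hx : x ∈ {x : E3 | 16 < ‖x‖ ∧ ‖x‖ < 128}) : x ≠ 0 := by
  rintro rfl
  rw [mem_setOf_eq, norm_zero] at hx
  linarith [hx.1]

/-- `inv 1` is `C²` on `U`. [folklore] -/
theorem bulkInversion_contDiffOn_inv_one : ContDiffOn ℝ 2 (inv 1) {x : E3 | 16 < ‖x‖ ∧ ‖x‖ < 128} :=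
  fun _ hx ↦ (bulkInversion_contDiffAt_inv_one (bulkInversion_ne_zero_of_mem hx)).contDiffWithinAt

/-- `x ↦ ‖x‖⁻¹` is `C²` on `U`. [folklore] -/
theorem bulkInversion_contDiffOn_norm_inv :
    ContDiffOn ℝ 2 (fun x : E3 ↦ ‖x‖⁻¹) {x : E3 | 16 < ‖x‖ ∧ ‖x‖ < 128} := fun _ hx ↦
  ((contDiffAt_norm ℝ (bulkInversion_ne_zero_of_mem hx)).inv
    (norm_ne_zero_iff.2 (bulkInversion_ne_zero_of_mem hx))).contDiffWithinAt

/-- `U` is open. [folklore] -/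
theorem bulkInversion_isOpen_U : IsOpen {x : E3 | 16 < ‖x‖ ∧ ‖x‖ < 128} :=
  isOpen_Ioo.preimage continuous_norm

/-- The shell `{1/128 < ‖z‖ < 1/16}` is open. [folklore] -/
theorem bulkInversion_isOpen_shell : IsOpen {z : E3 | 1 / 128 < ‖z‖ ∧ ‖z‖ < 1 / 16} :=
  isOpen_Ioo.preimage continuous_norm

/-- `inv 1` maps `U` into the shell. [folklore] -/
theorem bulkInversion_mapsTo :
    MapsTo (inv 1) {x : E3 | 16 < ‖x‖ ∧ ‖x‖ < 128} {z : E3 | 1 / 128 < ‖z‖ ∧ ‖z‖ < 1 / 16} := by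
  intro x hx
  have hpos : 0 < ‖x‖ := norm_pos_iff.2 (bulkInversion_ne_zero_of_mem hx)
  rw [mem_setOf_eq, bulkInversion_norm_inv_one]
  constructor
  · rw [one_div, inv_lt_inv₀ (by norm_num) hpos]
    exact hx.2
  · rw [one_div, inv_lt_inv₀ hpos (by norm_num)]
    exact hx.1

/-- The gluing annulus `{32 ≤ ‖x‖ ≤ 64}` is compact. [folklore] -/
theorem bulkInversion_isCompact_annulus : IsCompact {x : E3 | 32 ≤ ‖x‖ ∧ ‖x‖ ≤ 64} :=
  (isCompact_closedBall (0 : E3) 64).of_isClosed_subset (isClosed_Icc.preimage continuous_norm)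
    fun _ hx ↦ mem_closedBall_zero_iff.2 hx.2

/-- The gluing annulus lies in `U`. [folklore] -/
theorem bulkInversion_annulus_subset : {x : E3 | 32 ≤ ‖x‖ ∧ ‖x‖ ≤ 64} ⊆ {x : E3 | 16 < ‖x‖ ∧ ‖x‖ < 128} :=
  fun _ hx ↦ ⟨by linarith [hx.1], by linarith [hx.2]⟩

/-! ## §2 Uniform bounds for a fixed `C²` map on a compact part of an open set -/

/-- On a compact `A ⊆ U`, `U` open, the derivatives of orders `≤ 2` within `U` of a `C²` map on `U` are bounded by one
constant `B ≥ 1` (continuity of the derivatives + compactness). [folklore] -/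
theorem bulkInversion_exists_bound {F : Type*} [NormedAddCommGroup F] [NormedSpace ℝ F] {f : E3 → F} {U A : Set E3}
    (hU : IsOpen U) (hA : IsCompact A) (hAU : A ⊆ U) (hf : ContDiffOn ℝ 2 f U) :
    ∃ B : ℝ, 1 ≤ B ∧ ∀ x ∈ A, ∀ i : ℕ, i ≤ 2 → ‖iteratedFDerivWithin ℝ i f U x‖ ≤ B := by
  have key : ∀ i : ℕ, i ≤ 2 → ∃ B : ℝ, ∀ x ∈ A, ‖iteratedFDerivWithin ℝ i f U x‖ ≤ B := fun i hi ↦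
    hA.exists_bound_of_continuousOn
      ((hf.continuousOn_iteratedFDerivWithin (by exact_mod_cast hi) hU.uniqueDiffOn).mono hAU)
  obtain ⟨B₀, h₀⟩ := key 0 (by norm_num)
  obtain ⟨B₁, h₁⟩ := key 1 (by norm_num)
  obtain ⟨B₂, h₂⟩ := key 2 le_rfl
  refine ⟨max 1 (max B₀ (max B₁ B₂)), le_max_left _ _, fun x hx i hi ↦ ?_⟩
  interval_cases i
  · exact (h₀ x hx).trans (le_max_of_le_right (le_max_left _ _))
  · exact (h₁ x hx).trans (le_max_of_le_right (le_max_of_le_right (le_max_left _ _)))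
  · exact (h₂ x hx).trans (le_max_of_le_right (le_max_of_le_right (le_max_right _ _)))

/-! ## §3 The stub -/

/-- **Stub BK3e `stub_bulkInversion`** (reading a small field through the sheet-2 inversion): for `Φ` of `C²`-size `≤ ε` on
the shell `1/128 < ‖z‖ < 1/16`, the function `x ↦ ‖x‖⁻¹ Φ(x/‖x‖²)` has `C²`-size `≤ C ε` on the gluing annulus
`32 ≤ ‖x‖ ≤ 64` and is `C²` there, with a universal `C` (chain rule through the fixed smooth inversion `inv 1` and Leibniz with
the fixed smooth factor `‖x‖⁻¹`, on the open neighbourhood `{16 < ‖x‖ < 128}` of the annulus). [folklore] -/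
theorem stub_bulkInversion : ∃ C : ℝ, 0 < C ∧ ∀ (Φ : E3 → ℝ) (ε : ℝ), 0 ≤ ε →
    ContDiffOn ℝ 2 Φ {z : E3 | 1 / 128 < ‖z‖ ∧ ‖z‖ < 1 / 16} →
    (∀ z : E3, 1 / 128 < ‖z‖ → ‖z‖ < 1 / 16 → ∀ m : ℕ, m ≤ 2 → ‖iteratedFDeriv ℝ m Φ z‖ ≤ ε) →
    ∀ x : E3, 32 ≤ ‖x‖ → ‖x‖ ≤ 64 →
      (∀ m : ℕ, m ≤ 2 → ‖iteratedFDeriv ℝ m (fun x : E3 ↦ ‖x‖⁻¹ * Φ (inv 1 x)) x‖ ≤ C * ε) ∧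
      ContDiffAt ℝ 2 (fun x : E3 ↦ ‖x‖⁻¹ * Φ (inv 1 x)) x := by
  obtain ⟨D, hD1, hD⟩ := bulkInversion_exists_bound bulkInversion_isOpen_U bulkInversion_isCompact_annulus
    bulkInversion_annulus_subset bulkInversion_contDiffOn_inv_one
  obtain ⟨B, hB1, hB⟩ := bulkInversion_exists_bound bulkInversion_isOpen_U bulkInversion_isCompact_annulus
    bulkInversion_annulus_subset bulkInversion_contDiffOn_norm_inv
  have hD0 : 0 < D := by linarith
  have hB0 : 0 < B := by linarith
  refine ⟨8 * B * D ^ 2, by positivity, fun Φ ε hε hΦ hΦb x hx1 hx2 ↦ ?_⟩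
  have hUo := bulkInversion_isOpen_U
  have hSo := bulkInversion_isOpen_shell
  have hmaps := bulkInversion_mapsTo
  have hinv := bulkInversion_contDiffOn_inv_one
  have hnrm := bulkInversion_contDiffOn_norm_inv
  set U : Set E3 := {x : E3 | 16 < ‖x‖ ∧ ‖x‖ < 128}
  set S : Set E3 := {z : E3 | 1 / 128 < ‖z‖ ∧ ‖z‖ < 1 / 16}
  have hxA : x ∈ {x : E3 | 32 ≤ ‖x‖ ∧ ‖x‖ ≤ 64} := ⟨hx1, hx2⟩
  have hxU : x ∈ U := bulkInversion_annulus_subset hxA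
  have hcomp : ContDiffOn ℝ 2 (fun x : E3 ↦ Φ (inv 1 x)) U := hΦ.comp hinv hmaps
  have hF : ContDiffOn ℝ 2 (fun x : E3 ↦ ‖x‖⁻¹ * Φ (inv 1 x)) U := hnrm.mul hcomp
  refine ⟨fun m hm ↦ ?_, hF.contDiffAt (hUo.mem_nhds hxU)⟩
  -- the composition bound, at every order `k ≤ 2`
  have hcompk : ∀ k : ℕ, k ≤ 2 → ‖iteratedFDerivWithin ℝ k (fun x : E3 ↦ Φ (inv 1 x)) U x‖ ≤ 2 * ε * D ^ 2 := by
    intro k hk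
    have hkN : (k : WithTop ℕ∞) ≤ 2 := by exact_mod_cast hk
    have h1 : ‖iteratedFDerivWithin ℝ k (Φ ∘ inv 1) U x‖ ≤ k ! * ε * D ^ k :=
      norm_iteratedFDerivWithin_comp_le hΦ hinv hkN hSo.uniqueDiffOn hUo.uniqueDiffOn hmaps hxU
        (fun i hi ↦ by
          rw [iteratedFDerivWithin_of_isOpen i hSo (hmaps hxU)]
          exact hΦb _ (hmaps hxU).1 (hmaps hxU).2 i (hi.trans hk))
        (fun i hi1 hi2 ↦ (hD x hxA i (hi2.trans hk)).trans (le_self_pow₀ hD1 (by omega)))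
    have hfac : (k ! : ℝ) ≤ 2 := by
      interval_cases k <;> norm_num [Nat.factorial]
    have hDk : D ^ k ≤ D ^ 2 := pow_le_pow_right₀ hD1 hk
    calc ‖iteratedFDerivWithin ℝ k (fun x : E3 ↦ Φ (inv 1 x)) U x‖ = ‖iteratedFDerivWithin ℝ k (Φ ∘ inv 1) U x‖ := rfl
      _ ≤ k ! * ε * D ^ k := h1
      _ ≤ 2 * ε * D ^ 2 := mul_le_mul (mul_le_mul_of_nonneg_right hfac hε) hDk (by positivity) (by positivity)
  -- Leibniz with the factor `‖x‖⁻¹`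
  have hmN : (m : WithTop ℕ∞) ≤ 2 := by exact_mod_cast hm
  rw [← iteratedFDerivWithin_of_isOpen m hUo hxU]
  calc ‖iteratedFDerivWithin ℝ m (fun x : E3 ↦ ‖x‖⁻¹ * Φ (inv 1 x)) U x‖
      ≤ ∑ i ∈ Finset.range (m + 1), (m.choose i : ℝ) * ‖iteratedFDerivWithin ℝ i (fun x : E3 ↦ ‖x‖⁻¹) U x‖ *
          ‖iteratedFDerivWithin ℝ (m - i) (fun x : E3 ↦ Φ (inv 1 x)) U x‖ :=
        norm_iteratedFDerivWithin_mul_le hnrm hcomp hUo.uniqueDiffOn hxU hmN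
    _ ≤ ∑ i ∈ Finset.range (m + 1), (m.choose i : ℝ) * (B * (2 * ε * D ^ 2)) := by
        refine Finset.sum_le_sum fun i hi ↦ ?_
        have him : i ≤ m := Nat.lt_succ_iff.1 (Finset.mem_range.1 hi)
        rw [mul_assoc]
        exact mul_le_mul_of_nonneg_left
          (mul_le_mul (hB x hxA i (him.trans hm)) (hcompk (m - i) ((Nat.sub_le m i).trans hm))
            (norm_nonneg _) hB0.le) (Nat.cast_nonneg _)
    _ = 2 ^ m * (B * (2 * ε * D ^ 2)) := by
        rw [← Finset.sum_mul, ← Nat.cast_sum, Nat.sum_range_choose]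
        push_cast
        ring
    _ ≤ 2 ^ 2 * (B * (2 * ε * D ^ 2)) :=
        mul_le_mul_of_nonneg_right (pow_le_pow_right₀ (by norm_num) hm) (by positivity)
    _ = 8 * B * D ^ 2 * ε := by ring

end Summit.FinalStateConjecture.FinalStateConjecture.Theorems.SwallowTheDatum.ParametricKerrBurial
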